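import Summits.CriticalPhenomena.PercolationContinuityZ3.Theorems.PercNearOneGluingNoHeavyQuantLongTailPairHubAlg
import HarnessLib

/-!
# QUANT lane R8, T-DEC: ALGEBRA OF THE LONG-TAIL TRIPLE HUB — the closed-form inequalities behind the torque-cost certificate of the width-3 hub
# `S(γ₁) ∗ S(γ₂) ∗ S(γ₃)` of shape `{lo, lo+K; γ}` with `2lo ≤ K ≤ 3lo` at EVERY gate `γᵢ ≥ lo/K` (census-1 gen 32)

builds on p205010 (kernel theorem, internal audit signed; external expert review pending)

Support file (`--supports stmt-CriticalPhenomena-4575`), QUANT lane seat prim-quant-census-1 (gen 32); memo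
`run/shared/lean/prim/quant/prim-quant-census-1/g32/TWOLO-G32.md` §5–§6.  Theorems only (no definitions), standard axioms, no sorries; pure real
algebra (the SDEC theorem is `…QuantLongTailTripleHub`).

THE OBJECT.  The width-3 hub has atoms `3lo + Ks`, `s = 0..3`, masses `u₀ = (1−g₁)(1−g₂)(1−g₃)`, `u₁ = Σ gᵢ Π_{j≠i}(1−gⱼ)`, `u₂ = Σ_{i<j} gᵢgⱼ(1−g_k)`,
`u₃ = g₁g₂g₃` (`g₁` the least gate, `lo ≤ Kg₁`), mean `T₀ = 3lo + K(g₁+g₂+g₃)`, floor `x(lo+K) ≤ lo + Kg₁`.  For `K ≤ 3lo` the only positive low is `3lo`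
(`T > 6lo`) and the atom `3lo+K ≤ 6lo` is NEAR, compatible below `6lo+K`; `3lo+2K` is always compatible, near above `3lo+2K`.  Route (numerics: 0 failures
on 8 shapes, the top atom is never needed): the low to `3lo+K` while its credit capacity `(T−6lo)(u₀+u₁) ≤ K·u₁` lasts, to `3lo+2K` afterwards.  The closed
forms, in the order used by the route:
* **`ltTriple_capMid`** — the middle-low atom's floor capacity `(lo+Kg₁)(u₀+u₁) ≤ (lo+K)u₁` (`= (1−g₁)[u₁ − (lo+Kg₁)(1−g₂)(1−g₃)]·…`, by hand).
* **`ltTriple_capRho`** — the second atom's credit capacity, UNCONDITIONAL: `(K(g₁+g₂+g₃) − 3lo)(u₀+u₂) ≤ 2K·u₂` (Handelman certificate found by exact LP,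
  uniform in `lo/K ∈ [1/3, 1/2]`, checked by `linarith`).
* **`ltTriple_capTop`** — its floor capacity `(lo+Kg₁)(u₀+u₂) ≤ (lo+K)u₂` when the middle-low credit is exhausted at `a = 1`
  (`K·u₁ < (K(g₁+g₂+g₃)−3lo)(u₀+u₁)`) (certificate with the premise as a factor).
* **`ltTriple_cost0`** — the torque cost at the switching point: `x·u₀[(2K−3lo)u₀ + (K−3lo)u₁] ≤ 3lo(1−x)(u₀+u₁)²` (by hand: the second bracket term is
  `≤ 0`, `u₀+u₁ ≥ (1−g₂)(1−g₃)`, and `K(lo+Kg₁)(1−g₁) − 2lo(K−lo) = −(Kg₁−lo)(Kg₁−K+2lo) ≤ 0`, `2(2K−3lo)(K−lo) ≤ 3K²`).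

HONEST STATUS.  Algebra only; `SiblingStep`, `GluedDominatedMass`, `SDECConvClosed`, `FarTreeRow` OPEN; RATE class (log\*) / honest sentence of
`run/shared/lean/prim/quant/README.md` unchanged.  [this work].  Nothing here is cited as a published result.  The gluing rows served
[cite: KozmaNitzan2024, Conjecture 3 (p. 15)]; product measure [cite: Grimmett1999, §1.3 p. 10].
-/

noncomputable section

namespace Summit.CriticalPhenomena.PercolationContinuityZ3.Theorems
namespace Quant
namespace LawDec

/-! ### Floor capacity of the middle-low atom -/

/-- **the middle-low atom's floor capacity** (`g₁ ≤ g₂, g₃ ≤ 1`, `lo ≤ Kg₁`, `K ≥ 0`): `(lo+Kg₁)(u₀+u₁) ≤ (lo+K)·u₁`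
(`(lo+K)u₁ − (lo+Kg₁)(u₀+u₁) = (1−g₁)[K·u₁ − (lo+Kg₁)(1−g₂)(1−g₃)]` and `Kg₂(1−g₁) ≥ Kg₁(1−g₂) ≥ lo(1−g₂)`). [this work] -/
theorem ltTriple_capMid (lo K g₁ g₂ g₃ : ℝ) (hK : 0 ≤ K) (hg10 : 0 ≤ g₁) (hg : lo ≤ K * g₁) (h12 : g₁ ≤ g₂) (h13 : g₁ ≤ g₃) (h21 : g₂ ≤ 1)
    (h31 : g₃ ≤ 1) :
    (lo + K * g₁) * ((1 - g₁) * (1 - g₂) * (1 - g₃) + (g₁ * (1 - g₂) * (1 - g₃) + g₂ * (1 - g₁) * (1 - g₃) + g₃ * (1 - g₁) * (1 - g₂)))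
      ≤ (lo + K) * (g₁ * (1 - g₂) * (1 - g₃) + g₂ * (1 - g₁) * (1 - g₃) + g₃ * (1 - g₁) * (1 - g₂)) := by
  have hE1 : 0 ≤ 1 - g₁ := by linarith
  have hE2 : 0 ≤ 1 - g₂ := by linarith
  have hE3 : 0 ≤ 1 - g₃ := by linarith
  have hg3 : 0 ≤ g₃ := le_trans hg10 h13
  have e : (lo + K) * (g₁ * (1 - g₂) * (1 - g₃) + g₂ * (1 - g₁) * (1 - g₃) + g₃ * (1 - g₁) * (1 - g₂))
      - (lo + K * g₁) * ((1 - g₁) * (1 - g₂) * (1 - g₃) + (g₁ * (1 - g₂) * (1 - g₃) + g₂ * (1 - g₁) * (1 - g₃) + g₃ * (1 - g₁) * (1 - g₂)))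
      = (1 - g₁) * ((K * g₂ * (1 - g₁) * (1 - g₃) - lo * (1 - g₂) * (1 - g₃)) + K * g₃ * (1 - g₁) * (1 - g₂)) := by ring
  have h1 : lo * (1 - g₂) ≤ K * g₁ * (1 - g₂) := mul_le_mul_of_nonneg_right hg hE2
  have h2 : K * g₁ * (1 - g₂) ≤ K * g₂ * (1 - g₁) := by
    have : g₁ * (1 - g₂) ≤ g₂ * (1 - g₁) := by linarith
    have := mul_le_mul_of_nonneg_left this hK
    linarith
  have h3 : lo * (1 - g₂) * (1 - g₃) ≤ K * g₂ * (1 - g₁) * (1 - g₃) := mul_le_mul_of_nonneg_right (le_trans h1 h2) hE3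
  have h4 : 0 ≤ K * g₃ * (1 - g₁) * (1 - g₂) := by positivity
  have h5 : 0 ≤ (1 - g₁) * ((K * g₂ * (1 - g₁) * (1 - g₃) - lo * (1 - g₂) * (1 - g₃)) + K * g₃ * (1 - g₁) * (1 - g₂)) :=
    mul_nonneg hE1 (by linarith)
  linarith

/-! ### Capacities of the second atom (Handelman certificates) -/

/-- **the second atom's credit capacity, unconditional** (`2lo ≤ K ≤ 3lo`, gates in `[lo/K, 1]`):
`(K(g₁+g₂+g₃) − 3lo)(u₀+u₂) ≤ 2K·u₂`.  Certificate: 34 products of `Kgᵢ−lo, 1−gᵢ, 3lo−K, K−2lo, K` (float LP + exact repair, uniform in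
`lo/K ∈ [1/3,1/2]`; `linarith` re-derives the coefficients). [this work] -/
theorem ltTriple_capRho (lo K g₁ g₂ g₃ : ℝ) (hlo : 0 < lo) (hK2 : 2 * lo ≤ K) (hK3 : K ≤ 3 * lo) (hg₁ : lo ≤ K * g₁) (hg₂ : lo ≤ K * g₂)
    (hg₃ : lo ≤ K * g₃) (h11 : g₁ ≤ 1) (h21 : g₂ ≤ 1) (h31 : g₃ ≤ 1) :
    (K * (g₁ + g₂ + g₃) - 3 * lo) * ((1 - g₁) * (1 - g₂) * (1 - g₃) + (g₁ * g₂ * (1 - g₃) + g₁ * g₃ * (1 - g₂) + g₂ * g₃ * (1 - g₁)))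
      ≤ 2 * K * (g₁ * g₂ * (1 - g₃) + g₁ * g₃ * (1 - g₂) + g₂ * g₃ * (1 - g₁)) := by
  have hA1 : 0 ≤ K * g₁ - lo := sub_nonneg.2 hg₁
  have hA2 : 0 ≤ K * g₂ - lo := sub_nonneg.2 hg₂
  have hA3 : 0 ≤ K * g₃ - lo := sub_nonneg.2 hg₃
  have hE1 : 0 ≤ 1 - g₁ := sub_nonneg.2 h11
  have hE2 : 0 ≤ 1 - g₂ := sub_nonneg.2 h21
  have hE3 : 0 ≤ 1 - g₃ := sub_nonneg.2 h31
  have hClo : 0 ≤ 3 * lo - K := by linarith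
  have hChi : 0 ≤ K - 2 * lo := by linarith
  have hK : 0 < K := by linarith
  have key : 0 ≤ K * (2 * K * (g₁ * g₂ * (1 - g₃) + g₁ * g₃ * (1 - g₂) + g₂ * g₃ * (1 - g₁))
      - (K * (g₁ + g₂ + g₃) - 3 * lo) * ((1 - g₁) * (1 - g₂) * (1 - g₃) + (g₁ * g₂ * (1 - g₃) + g₁ * g₃ * (1 - g₂) + g₂ * g₃ * (1 - g₁)))) := by
    linarith [mul_nonneg (mul_nonneg hE3 hClo) hK.le,
      mul_nonneg (mul_nonneg hE3 hClo) hClo,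
      mul_nonneg (mul_nonneg (mul_nonneg hE3 hE3) hClo) hK.le,
      mul_nonneg (mul_nonneg hE2 hClo) hClo,
      mul_nonneg (mul_nonneg (mul_nonneg hE2 hE2) hClo) hK.le,
      mul_nonneg (mul_nonneg hE1 hClo) hK.le,
      mul_nonneg (mul_nonneg hE1 hClo) hClo,
      mul_nonneg (mul_nonneg (mul_nonneg hE1 hE3) hClo) hChi,
      mul_nonneg (mul_nonneg (mul_nonneg hE1 hE2) hClo) hChi,
      mul_nonneg (mul_nonneg (mul_nonneg (mul_nonneg (mul_nonneg hE1 hE2) hE3) hE3) hK.le) hK.le,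
      mul_nonneg (mul_nonneg (mul_nonneg hE1 hE1) hClo) hK.le,
      mul_nonneg (mul_nonneg hA3 hE2) hClo,
      mul_nonneg (mul_nonneg (mul_nonneg hA3 hE2) hE3) hK.le,
      mul_nonneg (mul_nonneg hA3 hE1) hClo,
      mul_nonneg (mul_nonneg (mul_nonneg hA3 hE1) hE3) hK.le,
      mul_nonneg (mul_nonneg (mul_nonneg hA3 hE1) hE1) hK.le,
      mul_nonneg (mul_nonneg (mul_nonneg hA3 hA3) hE1) hE2,
      mul_nonneg (mul_nonneg hA2 hE3) hClo,
      mul_nonneg (mul_nonneg (mul_nonneg hA2 hE3) hE3) hK.le,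
      mul_nonneg (mul_nonneg (mul_nonneg hA2 hE2) hE3) hK.le,
      mul_nonneg (mul_nonneg (mul_nonneg hA2 hE2) hE3) hClo,
      mul_nonneg (mul_nonneg (mul_nonneg hA2 hE1) hE2) hK.le,
      mul_nonneg (mul_nonneg (mul_nonneg hA2 hE1) hE1) hClo,
      mul_nonneg (mul_nonneg (mul_nonneg hA2 hA3) hE1) hE1,
      mul_nonneg (mul_nonneg (mul_nonneg hA2 hA2) hE1) hE3,
      mul_nonneg (mul_nonneg (mul_nonneg hA1 hE3) hE3) hK.le,
      mul_nonneg (mul_nonneg hA1 hE2) hClo,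
      mul_nonneg (mul_nonneg (mul_nonneg hA1 hE2) hE2) hClo,
      mul_nonneg (mul_nonneg (mul_nonneg hA1 hE1) hE3) hClo,
      mul_nonneg (mul_nonneg (mul_nonneg hA1 hE1) hE2) hK.le,
      mul_nonneg (mul_nonneg (mul_nonneg hA1 hA3) hE2) hE2,
      mul_nonneg (mul_nonneg (mul_nonneg hA1 hA2) hE2) hE3,
      mul_nonneg (mul_nonneg (mul_nonneg hA1 hA2) hE1) hE3,
      mul_nonneg (mul_nonneg (mul_nonneg hA1 hA1) hE2) hE3]
  nlinarith [key]

/-- **the second atom's floor capacity when the middle-low credit is exhausted** (`g₁` the least gate, `2lo ≤ K ≤ 3lo`): if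
`K·u₁ ≤ (K(g₁+g₂+g₃) − 3lo)(u₀+u₁)` then `(lo+Kg₁)(u₀+u₂) ≤ (lo+K)·u₂`.  Certificate: 21 products, one of them the premise (float LP + exact repair,
uniform in `lo/K ∈ [1/3,1/2]`). [this work] -/
theorem ltTriple_capTop (lo K g₁ g₂ g₃ : ℝ) (hlo : 0 < lo) (hK2 : 2 * lo ≤ K) (hK3 : K ≤ 3 * lo) (hg₁ : lo ≤ K * g₁) (h12 : g₁ ≤ g₂)
    (h13 : g₁ ≤ g₃) (h21 : g₂ ≤ 1) (h31 : g₃ ≤ 1)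
    (htop : K * (g₁ * (1 - g₂) * (1 - g₃) + g₂ * (1 - g₁) * (1 - g₃) + g₃ * (1 - g₁) * (1 - g₂))
      ≤ (K * (g₁ + g₂ + g₃) - 3 * lo) * ((1 - g₁) * (1 - g₂) * (1 - g₃) + (g₁ * (1 - g₂) * (1 - g₃) + g₂ * (1 - g₁) * (1 - g₃) + g₃ * (1 - g₁) * (1 - g₂)))) :
    (lo + K * g₁) * ((1 - g₁) * (1 - g₂) * (1 - g₃) + (g₁ * g₂ * (1 - g₃) + g₁ * g₃ * (1 - g₂) + g₂ * g₃ * (1 - g₁)))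
      ≤ (lo + K) * (g₁ * g₂ * (1 - g₃) + g₁ * g₃ * (1 - g₂) + g₂ * g₃ * (1 - g₁)) := by
  have hA1 : 0 ≤ K * g₁ - lo := sub_nonneg.2 hg₁
  have hE1 : 0 ≤ 1 - g₁ := by linarith
  have hE2 : 0 ≤ 1 - g₂ := sub_nonneg.2 h21
  have hE3 : 0 ≤ 1 - g₃ := sub_nonneg.2 h31
  have h21' : 0 ≤ g₂ - g₁ := sub_nonneg.2 h12
  have h31' : 0 ≤ g₃ - g₁ := sub_nonneg.2 h13
  have hClo : 0 ≤ 3 * lo - K := by linarith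
  have hChi : 0 ≤ K - 2 * lo := by linarith
  have hK : 0 < K := by linarith
  have hP : 0 ≤ (K * (g₁ + g₂ + g₃) - 3 * lo) * ((1 - g₁) * (1 - g₂) * (1 - g₃) + (g₁ * (1 - g₂) * (1 - g₃) + g₂ * (1 - g₁) * (1 - g₃) + g₃ * (1 - g₁) * (1 - g₂)))
      - K * (g₁ * (1 - g₂) * (1 - g₃) + g₂ * (1 - g₁) * (1 - g₃) + g₃ * (1 - g₁) * (1 - g₂)) := sub_nonneg.2 htop
  have key : 0 ≤ K * ((lo + K) * (g₁ * g₂ * (1 - g₃) + g₁ * g₃ * (1 - g₂) + g₂ * g₃ * (1 - g₁))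
      - (lo + K * g₁) * ((1 - g₁) * (1 - g₂) * (1 - g₃) + (g₁ * g₂ * (1 - g₃) + g₁ * g₃ * (1 - g₂) + g₂ * g₃ * (1 - g₁)))) := by
    linarith [mul_nonneg hP hK.le,
      mul_nonneg (mul_nonneg (mul_nonneg hE3 h21') hK.le) hK.le,
      mul_nonneg (mul_nonneg (mul_nonneg (mul_nonneg hE3 h21') h31') hK.le) hK.le,
      mul_nonneg (mul_nonneg (mul_nonneg (mul_nonneg hE3 h21') h21') hK.le) hK.le,
      mul_nonneg (mul_nonneg (mul_nonneg hE2 h31') hK.le) hK.le,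
      mul_nonneg (mul_nonneg (mul_nonneg (mul_nonneg hE2 h31') h31') hK.le) hK.le,
      mul_nonneg (mul_nonneg (mul_nonneg hE2 hE3) hClo) hClo,
      mul_nonneg (mul_nonneg (mul_nonneg (mul_nonneg hE1 h31') h31') hK.le) hK.le,
      mul_nonneg (mul_nonneg (mul_nonneg (mul_nonneg hE1 h21') h21') hK.le) hK.le,
      mul_nonneg (mul_nonneg (mul_nonneg hE1 hE3) hClo) hK.le,
      mul_nonneg (mul_nonneg (mul_nonneg hE1 hE2) hClo) hK.le,
      mul_nonneg (mul_nonneg (mul_nonneg (mul_nonneg hE1 hE2) hE3) hChi) hK.le,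
      mul_nonneg (mul_nonneg (mul_nonneg (mul_nonneg (mul_nonneg hE1 hE2) hE3) h31') hK.le) hK.le,
      mul_nonneg (mul_nonneg (mul_nonneg (mul_nonneg (mul_nonneg hE1 hE2) hE3) h21') hK.le) hK.le,
      mul_nonneg (mul_nonneg (mul_nonneg hE1 hE1) hClo) hK.le,
      mul_nonneg (mul_nonneg (mul_nonneg (mul_nonneg (mul_nonneg hE1 hE1) hE2) hE3) hK.le) hK.le,
      mul_nonneg (mul_nonneg (mul_nonneg hA1 hE3) h21') hK.le,
      mul_nonneg (mul_nonneg (mul_nonneg hA1 hE2) h31') hK.le,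
      mul_nonneg (mul_nonneg (mul_nonneg hA1 hE2) hE3) hClo,
      mul_nonneg (mul_nonneg (mul_nonneg hA1 hE1) hE3) hK.le,
      mul_nonneg (mul_nonneg (mul_nonneg hA1 hE1) hE1) hK.le]
  nlinarith [key]

/-! ### The cost at the switching point -/

/-- `K(lo+Kg)(1−g) ≤ 2lo(K−lo)` for `lo ≤ Kg`, `K ≤ 3lo` (`2lo(K−lo) − K(lo+Kg)(1−g) = (Kg−lo)(Kg−K+2lo)`). [this work] -/
theorem ltTriple_parabola (lo K g : ℝ) (hg : lo ≤ K * g) (hK3 : K ≤ 3 * lo) : K * (lo + K * g) * (1 - g) ≤ 2 * lo * (K - lo) := by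
  have e : 2 * lo * (K - lo) - K * (lo + K * g) * (1 - g) = (K * g - lo) * (K * g - K + 2 * lo) := by ring
  have h := mul_nonneg (sub_nonneg.2 hg) (show 0 ≤ K * g - K + 2 * lo by linarith)
  linarith

/-- **the torque cost at the switching point** (`2lo ≤ K ≤ 3lo`, `0 < lo`, `lo ≤ Kg₁`, `g₁ ≤ g₂, g₃ ≤ 1`, `0 ≤ x`, `x(lo+K) ≤ lo+Kg₁`):
`x·u₀·[(2K−3lo)u₀ + (K−3lo)u₁] ≤ 3lo(1−x)(u₀+u₁)²`. [this work] -/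
theorem ltTriple_cost0 (lo K g₁ g₂ g₃ x : ℝ) (hlo : 0 < lo) (hK2 : 2 * lo ≤ K) (hK3 : K ≤ 3 * lo) (hg : lo ≤ K * g₁) (h12 : g₁ ≤ g₂)
    (h13 : g₁ ≤ g₃) (h21 : g₂ ≤ 1) (h31 : g₃ ≤ 1) (hx0 : 0 ≤ x) (hxg : x * (lo + K) ≤ lo + K * g₁) :
    x * ((1 - g₁) * (1 - g₂) * (1 - g₃)) * ((2 * K - 3 * lo) * ((1 - g₁) * (1 - g₂) * (1 - g₃))
        + (K - 3 * lo) * (g₁ * (1 - g₂) * (1 - g₃) + g₂ * (1 - g₁) * (1 - g₃) + g₃ * (1 - g₁) * (1 - g₂)))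
      ≤ 3 * lo * (1 - x) * ((1 - g₁) * (1 - g₂) * (1 - g₃) + (g₁ * (1 - g₂) * (1 - g₃) + g₂ * (1 - g₁) * (1 - g₃) + g₃ * (1 - g₁) * (1 - g₂))) ^ 2 := by
  have hK0 : 0 < K := by linarith
  have hB0 : 0 < lo + K := by linarith
  have hE1 : 0 ≤ 1 - g₁ := by linarith
  have hE2 : 0 ≤ 1 - g₂ := by linarith
  have hE3 : 0 ≤ 1 - g₃ := by linarith
  have hg10 : 0 ≤ g₁ := by
    by_contra hc; push Not at hc; have := mul_neg_of_pos_of_neg hK0 hc; linarith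
  have hg2 : 0 ≤ g₂ := le_trans hg10 h12
  have hg3 : 0 ≤ g₃ := le_trans hg10 h13
  set E23 : ℝ := (1 - g₂) * (1 - g₃) with eE23
  have hE23n : 0 ≤ E23 := mul_nonneg hE2 hE3
  set u0 : ℝ := (1 - g₁) * (1 - g₂) * (1 - g₃) with hu0
  set u1 : ℝ := g₁ * (1 - g₂) * (1 - g₃) + g₂ * (1 - g₁) * (1 - g₃) + g₃ * (1 - g₁) * (1 - g₂) with hu1
  have eu0 : u0 = (1 - g₁) * E23 := by rw [hu0, eE23]; ring
  have hu0n : 0 ≤ u0 := by rw [eu0]; exact mul_nonneg hE1 hE23n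
  have hu1n : 0 ≤ u1 := by rw [hu1]; positivity
  set W : ℝ := u0 + u1 with hW
  have hWE : E23 ≤ W := by
    have e : W - E23 = g₂ * (1 - g₁) * (1 - g₃) + g₃ * (1 - g₁) * (1 - g₂) := by rw [hW, hu0, hu1, eE23]; ring
    have : 0 ≤ g₂ * (1 - g₁) * (1 - g₃) + g₃ * (1 - g₁) * (1 - g₂) := by positivity
    linarith
  have hx1 : x ≤ 1 := by
    by_contra hc; push Not at hc
    have h1 : 1 * (lo + K) < x * (lo + K) := mul_lt_mul_of_pos_right hc hB0
    have h2 : K * g₁ ≤ K * 1 := mul_le_mul_of_nonneg_left (by linarith) hK0.le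
    linarith
  -- step 1: drop the `(K − 3lo)u₁ ≤ 0` term
  have s1 : x * u0 * ((2 * K - 3 * lo) * u0 + (K - 3 * lo) * u1) ≤ (2 * K - 3 * lo) * x * u0 ^ 2 := by
    have hneg : x * u0 * ((K - 3 * lo) * u1) ≤ 0 :=
      mul_nonpos_of_nonneg_of_nonpos (mul_nonneg hx0 hu0n) (mul_nonpos_of_nonpos_of_nonneg (by linarith) hu1n)
    have e : x * u0 * ((2 * K - 3 * lo) * u0 + (K - 3 * lo) * u1) = (2 * K - 3 * lo) * x * u0 ^ 2 + x * u0 * ((K - 3 * lo) * u1) := by ring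
    linarith
  -- step 2: `(2K−3lo)·x·(1−g₁)² ≤ 3lo(1−x)`
  have s2 : (2 * K - 3 * lo) * x * (1 - g₁) ^ 2 ≤ 3 * lo * (1 - x) := by
    have hP := ltTriple_parabola lo K g₁ hg hK3
    have c23 : 0 ≤ 2 * K - 3 * lo := by linarith
    -- (a) `K(lo+K)·LHS ≤ K(2K−3lo)(1−g₁)²(lo+Kg₁)`
    have a1 : K * (2 * K - 3 * lo) * (1 - g₁) ^ 2 * (x * (lo + K)) ≤ K * (2 * K - 3 * lo) * (1 - g₁) ^ 2 * (lo + K * g₁) :=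
      mul_le_mul_of_nonneg_left hxg (mul_nonneg (mul_nonneg hK0.le c23) (sq_nonneg _))
    -- (b) `(2K−3lo)(1−g₁)·[K(lo+Kg₁)(1−g₁)] ≤ (2K−3lo)(1−g₁)·2lo(K−lo)`
    have a2 : (2 * K - 3 * lo) * (1 - g₁) * (K * (lo + K * g₁) * (1 - g₁)) ≤ (2 * K - 3 * lo) * (1 - g₁) * (2 * lo * (K - lo)) :=
      mul_le_mul_of_nonneg_left hP (mul_nonneg c23 hE1)
    -- (c) `(2K−3lo)·2lo(K−lo) ≤ 3loK²`
    have a3 : (2 * K - 3 * lo) * (2 * lo * (K - lo)) ≤ 3 * lo * K ^ 2 := by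
      have h := mul_nonneg (sub_nonneg.2 hK2) (show 0 ≤ 3 * lo - K by linarith)
      nlinarith [mul_pos hlo hK0]
    have a4 : (1 - g₁) * ((2 * K - 3 * lo) * (2 * lo * (K - lo))) ≤ (1 - g₁) * (3 * lo * K ^ 2) := mul_le_mul_of_nonneg_left a3 hE1
    -- (d) `3loK²(1−g₁) = 3loK((lo+K) − (lo+Kg₁)) ≤ 3loK(lo+K)(1−x)`
    have a5 : 3 * lo * K * ((lo + K) - (lo + K * g₁)) ≤ 3 * lo * K * ((lo + K) - x * (lo + K)) := by
      have := mul_le_mul_of_nonneg_left (show (lo + K) - (lo + K * g₁) ≤ (lo + K) - x * (lo + K) by linarith)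
        (show (0 : ℝ) ≤ 3 * lo * K by positivity)
      exact this
    have key : K * (lo + K) * ((2 * K - 3 * lo) * x * (1 - g₁) ^ 2) ≤ K * (lo + K) * (3 * lo * (1 - x)) := by
      have e1 : K * (lo + K) * ((2 * K - 3 * lo) * x * (1 - g₁) ^ 2) = K * (2 * K - 3 * lo) * (1 - g₁) ^ 2 * (x * (lo + K)) := by ring
      have e2 : K * (2 * K - 3 * lo) * (1 - g₁) ^ 2 * (lo + K * g₁) = (2 * K - 3 * lo) * (1 - g₁) * (K * (lo + K * g₁) * (1 - g₁)) := by ring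
      have e3 : (2 * K - 3 * lo) * (1 - g₁) * (2 * lo * (K - lo)) = (1 - g₁) * ((2 * K - 3 * lo) * (2 * lo * (K - lo))) := by ring
      have e4 : (1 - g₁) * (3 * lo * K ^ 2) = 3 * lo * K * ((lo + K) - (lo + K * g₁)) := by ring
      have e5 : 3 * lo * K * ((lo + K) - x * (lo + K)) = K * (lo + K) * (3 * lo * (1 - x)) := by ring
      linarith
    exact le_of_mul_le_mul_left key (mul_pos hK0 hB0)
  have s3 : (2 * K - 3 * lo) * x * u0 ^ 2 ≤ 3 * lo * (1 - x) * E23 ^ 2 := by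
    have h := mul_le_mul_of_nonneg_right s2 (sq_nonneg E23)
    have e : (2 * K - 3 * lo) * x * u0 ^ 2 = (2 * K - 3 * lo) * x * (1 - g₁) ^ 2 * E23 ^ 2 := by rw [eu0]; ring
    rw [e]; linarith
  have s4 : 3 * lo * (1 - x) * E23 ^ 2 ≤ 3 * lo * (1 - x) * W ^ 2 := by
    have : E23 ^ 2 ≤ W ^ 2 := pow_le_pow_left₀ hE23n hWE 2
    exact mul_le_mul_of_nonneg_left this (mul_nonneg (by linarith) (by linarith))
  linarith

end LawDec
end Quant
end Summit.CriticalPhenomena.PercolationContinuityZ3.Theorems
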